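import Literature.Combinatorics.Optimization.PsdRankComparisons
import Literature.Combinatorics.Optimization.PsdLiftSlackMatrix
import Mathlib.Algebra.MvPolynomial.Funext
import Mathlib.Algebra.Polynomial.Roots
import Mathlib.Algebra.Polynomial.Degree.SmallDegree
import Mathlib.Topology.Algebra.MvPolynomial
import HarnessLib

/-!
# The psd rank of an `n`-dimensional polytope is at least `n + 1` (Gouveia–Robinson–Thomas 2013; FGPRT 2015, Cor. 5.9)

Sources. J. Gouveia, R. Z. Robinson, R. R. Thomas, *Polytopes of minimum positive semidefinite
rank*, Discrete Comput. Geom. 50 (2013) 679–699 = arXiv:1205.5306 [GouveiaRobinsonThomas2013],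
§3: Lemma 3.1 (`rank S_P = n + 1`) and Proposition 3.2 ("If `P ⊂ ℝⁿ` is a full-dimensional
polytope, then the psd rank of `P` is at least `n+1`", held text `paper:arxiv-1205.5306` p07);
restated as Corollary 5.9 of H. Fawzi, J. Gouveia, P. A. Parrilo, R. Z. Robinson, R. R. Thomas,
*Positive semidefinite rank*, Math. Program. 153 (2015) 133–177 [FawziEtAl2015] (held text
`paper:arxiv-1407.4095` p15: "If `P` is an `n`-dimensional polytope with slack matrix `S_P`, then
`rank(S_P) = n+1 ≤ rank_psd(S_P)`"), which the tree types as the named fact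
`FawziEtAl2015_cor59` (`PsdRankComparisons.lean`). This file DISCHARGES it:
`FawziEtAl2015_cor59_holds`.

Proof architecture. The rank half is `rank_pairSlackMatrix_eq_finrank_add_one`
(`PsdLiftSlackMatrix.lean`). For the psd half, GRT prove Prop. 3.2 by induction on `n` along a
facet `F`: the slack matrix contains the block `[S_F 0; * α]`, `α > 0`. Unrolled, the induction
produces an `(n+1) × (n+1)` TRIANGULAR support pattern (inequality `γ_t` slack at the point
`x_{ρ t}` and tight at `x_{ρ s}`, `s < t`) — FGPRT's remark before Cor. 5.9 that slack matrices
"achieve the minimum rank possible among all matrices sharing [their] support" (Lee–Theis) — and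
the tree's psd fooling-set bound `HasPsdFactorization.card_le_of_triangular`
(`PsdRankBasicProperties.lean`, FGPRT Thm. 2.10/Ex. 2.11) turns the pattern into `rank_psd ≥ n+1`.
The polytope is handled throughout in the `V`/`H`-DESCRIPTION form of the fact
(`conv{x_i} = {y : a_jᵀ y ≤ b_j}` in `ℝ^d`, dimension = `finrank (vectorSpan {x_i})`), with no
face-lattice theory: the one geometric input, the existence of a facet-defining inequality among
the `a_j` (`exists_facet_inequality`), is proved from a MINIMAL sub-system of the inequalities that
still cuts out `P` (a point violating exactly one inequality `c` of it, joined to the centroid of the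
`x_i`, gives a point of the face `a_c = b_c` strictly inside all other relevant inequalities), and the
facet's dimension drop is a rank–nullity count (`finrank_vectorSpan_tight_add_one`). Faces are
re-described in the same `V`/`H` form (tight points; the reversed inequality adjoined as index
`none : Option κ`, `convexHull_range_tight_eq_option`) so that the induction
(`exists_slack_triangular`) runs inside the fact's own vocabulary.

Contents: `exists_facet_inequality`, `convexHull_range_tight_eq` (a face is the hull of its tight
points), `finrank_vectorSpan_tight_add_one`, `exists_slack_triangular` (the flag),
`add_one_le_of_hasPsdFactorization_slack` (`rank_psd S_P ≥ dim P + 1` for arbitrary finite index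
types), `FawziEtAl2015_cor59_holds`; and (appended) GRT Prop. 2.6 (bordering raises the psd rank:
`HasPsdFactorization.exists_lt_of_bordered`, via `FawziEtAl2015_thm210_holds`) with GRT Prop. 3.8
(`rank_psd P ≥ rank_psd F + 1` for a face `F` cut out by an inequality of the description:
`exists_hasPsdFactorization_tight_of_slack`); GRT Def. 4.1/Cor. 4.2 (a 2-level `V`/`H` polytope of
dimension `n` has psd factorizations of exactly the sizes `≥ n + 1`: `hasPsdFactorization_iff_of_twoLevel`)
and FGPRT Example 3.5 (the square: `rank_psd [1 1 0 0; 0 1 1 0; 0 0 1 1; 1 0 0 1] = 3`, `FawziEtAl2015_ex35`,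
a non-vacuity witness for the hypotheses of Cor. 5.9); and the same bound for `H`-descriptions with
equality rows (`add_one_le_of_hasPsdFactorization_slack_of_eq`); and (section `Cor513`) **FGPRT
Corollary 5.13 from Proposition 5.12** (`FawziEtAl2015_cor513_of_prop512`: "the degree of a polytope
is its number of facets" — the polynomial of Prop. 5.12 vanishes on a relatively open piece of each of
the `f` distinct facet hyperplanes of an irredundant description, hence on the hyperplanes (restriction
to lines, `Polynomial.eq_zero_of_infinite_isRoot`), and a generic line through a point where it is
nonzero meets them in `f` distinct roots; the `S^k_+`-lift comes from `FawziEtAl2015_thm33_holds`), so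
that `FawziEtAl2015_cor513` is open modulo Renegar's bound `FawziEtAl2015_prop512` only.

NOT here: the second half of GRT Prop. 3.2 (all factors of a `S^{n+1}_+`-factorization have rank
one) and GRT Thm. 3.5/§4 (characterisation of psd-minimal polytopes via Hadamard square roots /
2-level polytopes).
-/

noncomputable section

open Matrix Finset
open scoped MatrixOrder

namespace Literature.Combinatorics.Optimization

variable {d : ℕ} {ι κ : Type*}

/-! ### Preliminaries on `V`/`H`-described polytopes -/

/-- A bounded set contains no ray: if `y + t z ∈ Q` for all `t ≥ 0` and `Q` is bounded then `z = 0`.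
[folklore] -/
private theorem eq_zero_of_ray_subset_of_isBounded {Q : Set (Fin d → ℝ)} (hQ : Bornology.IsBounded Q)
    {y z : Fin d → ℝ} (h : ∀ t : ℝ, 0 ≤ t → y + t • z ∈ Q) : z = 0 := by
  obtain ⟨R, hR⟩ := isBounded_iff_forall_norm_le.mp hQ
  by_contra hz
  have hzn : 0 < ‖z‖ := norm_pos_iff.mpr hz
  have hy : ‖y‖ ≤ R := by simpa using hR _ (h 0 le_rfl)
  set t : ℝ := (R + ‖y‖ + 1) / ‖z‖ with ht_def
  have ht : 0 ≤ t := div_nonneg (by linarith [norm_nonneg y]) hzn.le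
  have hmem := hR _ (h t ht)
  have htz : t * ‖z‖ = R + ‖y‖ + 1 := div_mul_cancel₀ _ hzn.ne'
  have h1 : ‖t • z‖ ≤ ‖y + t • z‖ + ‖y‖ := by
    have := norm_sub_le (y + t • z) y
    rwa [add_sub_cancel_left] at this
  rw [norm_smul, Real.norm_of_nonneg ht] at h1
  linarith

/-- The points of a `V`-description lie in the polytope: `a_jᵀ x_i ≤ b_j`. [folklore] -/
private theorem dotProduct_le_of_convexHull_eq (x : ι → (Fin d → ℝ)) (a : κ → (Fin d → ℝ)) (b : κ → ℝ)
    (hP : convexHull ℝ (Set.range x) = {y | ∀ j, a j ⬝ᵥ y ≤ b j}) (i : ι) (j : κ) :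
    a j ⬝ᵥ x i ≤ b j := by
  have hi : x i ∈ {y : Fin d → ℝ | ∀ j, a j ⬝ᵥ y ≤ b j} := by
    rw [← hP]; exact subset_convexHull ℝ _ (Set.mem_range_self i)
  exact hi j

/-- A `V`/`H`-described polytope is bounded. [folklore] -/
private theorem isBounded_of_convexHull_eq [Finite ι] (x : ι → (Fin d → ℝ)) (a : κ → (Fin d → ℝ)) (b : κ → ℝ)
    (hP : convexHull ℝ (Set.range x) = {y | ∀ j, a j ⬝ᵥ y ≤ b j}) :
    Bornology.IsBounded {y : Fin d → ℝ | ∀ j, a j ⬝ᵥ y ≤ b j} := by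
  rw [← hP]; exact isBounded_convexHull.mpr (Set.finite_range x).isBounded

/-- If some point of the `V`-description is tight on EVERY inequality of the `H`-description, the
polytope is that single point (otherwise it would contain the ray from it through any other point).
[folklore] -/
private theorem eq_of_forall_slack_eq_zero [Finite ι] (x : ι → (Fin d → ℝ)) (a : κ → (Fin d → ℝ)) (b : κ → ℝ)
    (hP : convexHull ℝ (Set.range x) = {y | ∀ j, a j ⬝ᵥ y ≤ b j}) {q : ι}
    (hq : ∀ j, a j ⬝ᵥ x q = b j) (i : ι) : x i = x q := by
  have hxP := dotProduct_le_of_convexHull_eq x a b hP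
  have hz := eq_zero_of_ray_subset_of_isBounded (isBounded_of_convexHull_eq x a b hP) (y := x q)
    (z := x i - x q) fun t ht j => by
      show a j ⬝ᵥ (x q + t • (x i - x q)) ≤ b j
      rw [dotProduct_add, dotProduct_smul, dotProduct_sub, hq j, smul_eq_mul]
      nlinarith [hxP i j]
  exact sub_eq_zero.mp hz

/-- A point family with positive-dimensional affine span has two distinct members. [folklore] -/
private theorem exists_ne_of_finrank_vectorSpan_ne_zero (x : ι → (Fin d → ℝ))
    (hD : Module.finrank ℝ (vectorSpan ℝ (Set.range x)) ≠ 0) : ∃ p q, x p ≠ x q := by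
  by_contra! h
  apply hD
  rcases isEmpty_or_nonempty ι with hι | ⟨⟨q⟩⟩
  · rw [Set.range_eq_empty x, vectorSpan_empty, finrank_bot]
  · have hrange : Set.range x = {x q} := by
      ext y
      simp only [Set.mem_range, Set.mem_singleton_iff]
      exact ⟨fun ⟨i, hi⟩ => hi ▸ h i q, fun hy => ⟨q, hy.symm⟩⟩
    rw [hrange, vectorSpan_singleton, finrank_bot]

/-- A positive-dimensional `V`/`H`-polytope has a point of its `V`-description that is slack on some
inequality (its slack matrix is not zero). [folklore] -/
private theorem exists_dotProduct_ne_of_finrank_ne_zero [Finite ι] (x : ι → (Fin d → ℝ)) (a : κ → (Fin d → ℝ))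
    (b : κ → ℝ) (hP : convexHull ℝ (Set.range x) = {y | ∀ j, a j ⬝ᵥ y ≤ b j})
    (hD : Module.finrank ℝ (vectorSpan ℝ (Set.range x)) ≠ 0) : ∃ i j, a j ⬝ᵥ x i ≠ b j := by
  obtain ⟨p, q, hpq⟩ := exists_ne_of_finrank_vectorSpan_ne_zero x hD
  by_contra! h
  exact hpq (eq_of_forall_slack_eq_zero x a b hP (q := q) (h q) p)

/-- An inequality tight at every point of the `V`-description annihilates the direction space
`lin(P) = vectorSpan {x_i}`. [folklore] -/
private theorem dotProduct_eq_zero_of_mem_vectorSpan (x : ι → (Fin d → ℝ)) {a₀ : Fin d → ℝ} {b₀ : ℝ}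
    (h : ∀ i, a₀ ⬝ᵥ x i = b₀) {u : Fin d → ℝ} (hu : u ∈ vectorSpan ℝ (Set.range x)) :
    a₀ ⬝ᵥ u = 0 := by
  rw [vectorSpan_def] at hu
  induction hu using Submodule.span_induction with
  | mem v hv =>
    obtain ⟨_, ⟨i, rfl⟩, _, ⟨i', rfl⟩, rfl⟩ := hv
    simp only [vsub_eq_sub, dotProduct_sub, h i, h i', sub_self]
  | zero => exact dotProduct_zero _
  | add v v' _ _ hv hv' => rw [dotProduct_add, hv, hv', add_zero]
  | smul r v _ hv => rw [dotProduct_smul, hv, smul_zero]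

/-- Membership in the convex hull of a finitely indexed family as a convex combination with weights
on the whole index type. [folklore] -/
private theorem mem_convexHull_range_iff_exists_fintype_weights [Fintype ι] {E : Type*} [AddCommGroup E]
    [Module ℝ E] (x : ι → E) (y : E) :
    y ∈ convexHull ℝ (Set.range x) ↔
      ∃ w : ι → ℝ, (∀ i, 0 ≤ w i) ∧ ∑ i, w i = 1 ∧ ∑ i, w i • x i = y := by
  classical
  constructor
  · intro hy
    rw [convexHull_range_eq_exists_affineCombination] at hy
    obtain ⟨s, w, hw₀, hw₁, rfl⟩ := hy
    refine ⟨fun i => if i ∈ s then w i else 0, fun i => ?_, ?_, ?_⟩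
    · by_cases hi : i ∈ s
      · simpa [hi] using hw₀ i hi
      · simp [hi]
    · rw [Finset.sum_ite_mem, Finset.univ_inter, hw₁]
    · rw [Finset.affineCombination_eq_linear_combination s x w hw₁]
      simp only [ite_smul, zero_smul, Finset.sum_ite_mem, Finset.univ_inter]
  · rintro ⟨w, hw₀, hw₁, hy⟩
    exact mem_convexHull_of_exists_fintype w x hw₀ hw₁ (fun i => Set.mem_range_self i) hy

/-! ### A facet-defining inequality exists -/

/-- **Facet lemma.** Let `P = conv{x_i} = {y : a_jᵀ y ≤ b_j ∀ j}` be a `V`/`H`-described polytope of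
positive dimension. Then some inequality `c` of the description defines a FACET in the following
concrete sense: `c` is slack at some `x_p`, and there is a point `w ∈ P` tight at `c` from which
every direction `u ∈ lin(P)` with `a_cᵀ u = 0` can be followed inside `P` for a positive distance.
Proof: let `J'` be the inequalities slack at some `x_i`; choose `T ⊆ J'` of minimum size with
`{y : a_jᵀy ≤ b_j (j ∉ J'), a_jᵀ y ≤ b_j (j ∈ T)} ⊆ P`; `T ≠ ∅` by boundedness; for `c ∈ T` minimality
gives `z` violating only `c`; `w` is the point of the segment from the centroid of the `x_i` to `z`
at which `a_cᵀ w = b_c` — it is strictly feasible for `T ∖ {c}`. This is Schrijver's proof of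
Theorem 8.1 (ii) ("there exists an `x₀` with `A⁻x₀ = b⁻, a x₀ = β, A'x₀ < b'` … some convex
combination `x₀` of `x₁` and `x₂` has the required properties"), written for a `V`/`H` pair.
[cite: Schrijver1986, §8.4 Thm. 8.1, proof part (ii) (held text p0195)] -/
theorem exists_facet_inequality [Fintype ι] [Fintype κ] (x : ι → (Fin d → ℝ)) (a : κ → (Fin d → ℝ))
    (b : κ → ℝ) (hP : convexHull ℝ (Set.range x) = {y | ∀ j, a j ⬝ᵥ y ≤ b j})
    (hD : Module.finrank ℝ (vectorSpan ℝ (Set.range x)) ≠ 0) :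
    ∃ (c : κ) (p : ι) (w : Fin d → ℝ), a c ⬝ᵥ x p < b c ∧ (∀ j, a j ⬝ᵥ w ≤ b j) ∧ a c ⬝ᵥ w = b c ∧
      ∀ u ∈ vectorSpan ℝ (Set.range x), a c ⬝ᵥ u = 0 →
        ∃ t : ℝ, 0 < t ∧ ∀ j, a j ⬝ᵥ (w + t • u) ≤ b j := by
  classical
  have hxP := dotProduct_le_of_convexHull_eq x a b hP
  have hbdd := isBounded_of_convexHull_eq x a b hP
  obtain ⟨p₀, q₀, hpq⟩ := exists_ne_of_finrank_vectorSpan_ne_zero x hD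
  -- the inequalities that are slack at some point of the `V`-description
  set J' : Finset κ := univ.filter fun j => ∃ i, a j ⬝ᵥ x i ≠ b j with hJ'
  have hJ'out : ∀ j, j ∉ J' → ∀ i, a j ⬝ᵥ x i = b j := by
    intro j hj i
    by_contra h
    exact hj (by rw [hJ', mem_filter]; exact ⟨mem_univ _, i, h⟩)
  have hJ'in : ∀ j, j ∈ J' → ∃ i, a j ⬝ᵥ x i < b j := by
    intro j hj
    rw [hJ', mem_filter] at hj
    obtain ⟨i, hi⟩ := hj.2
    exact ⟨i, lt_of_le_of_ne (hxP i j) hi⟩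
  -- the sub-systems `P_T`
  set P : Set (Fin d → ℝ) := {y | ∀ j, a j ⬝ᵥ y ≤ b j} with hPdef
  let PT : Finset κ → Set (Fin d → ℝ) := fun T =>
    {y | (∀ j, j ∉ J' → a j ⬝ᵥ y ≤ b j) ∧ ∀ j ∈ T, a j ⬝ᵥ y ≤ b j}
  have hex : ∃ m, ∃ T : Finset κ, T ⊆ J' ∧ T.card = m ∧ PT T ⊆ P :=
    ⟨_, J', subset_rfl, rfl, fun y hy j => if hj : j ∈ J' then hy.2 j hj else hy.1 j hj⟩
  obtain ⟨T, hTJ, hTcard, hTgood⟩ := Nat.find_spec hex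
  have hmin : ∀ T' : Finset κ, T' ⊆ J' → T'.card < T.card → ¬ (PT T' ⊆ P) := fun T' h1 h2 h3 =>
    Nat.find_min hex (hTcard ▸ h2) ⟨T', h1, rfl, h3⟩
  -- `T` is nonempty: otherwise the ray from `x q₀` through `x p₀` stays in `P_∅ ⊆ P`
  have hTne : T.Nonempty := by
    rw [Finset.nonempty_iff_ne_empty]
    rintro rfl
    refine hpq (sub_eq_zero.mp (eq_zero_of_ray_subset_of_isBounded hbdd (y := x q₀)
      (z := x p₀ - x q₀) fun t _ => hTgood ⟨fun j hj => ?_, fun j hj => by simp at hj⟩))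
    rw [dotProduct_add, dotProduct_smul, dotProduct_sub, hJ'out j hj q₀, hJ'out j hj p₀, sub_self,
      smul_zero, add_zero]
  obtain ⟨c, hcT⟩ := hTne
  obtain ⟨p, hcp⟩ := hJ'in c (hTJ hcT)
  -- minimality: a point `z` violating only `c`
  have hbad : ¬ (PT (T.erase c) ⊆ P) :=
    hmin _ ((erase_subset c T).trans hTJ) (card_erase_lt_of_mem hcT)
  obtain ⟨z, hzT, hzP⟩ := Set.not_subset.mp hbad
  have hcz : b c < a c ⬝ᵥ z := by
    by_contra! h
    refine hzP (hTgood ⟨hzT.1, fun j hj => ?_⟩)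
    by_cases hjc : j = c
    · rw [hjc]; exact h
    · exact hzT.2 j (mem_erase.mpr ⟨hjc, hj⟩)
  -- the centroid `y₀` of the `x_i`
  have hN : (0 : ℝ) < Fintype.card ι := by exact_mod_cast Fintype.card_pos_iff.mpr ⟨p₀⟩
  obtain ⟨y₀, hy₀⟩ : ∃ y₀ : Fin d → ℝ, y₀ = (Fintype.card ι : ℝ)⁻¹ • ∑ i, x i := ⟨_, rfl⟩
  have hay₀ : ∀ j, a j ⬝ᵥ y₀ = (Fintype.card ι : ℝ)⁻¹ * ∑ i, a j ⬝ᵥ x i := fun j => by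
    rw [hy₀, dotProduct_smul, dotProduct_sum, smul_eq_mul]
  have hy₀le : ∀ j, a j ⬝ᵥ y₀ ≤ b j := fun j => by
    rw [hay₀]
    calc (Fintype.card ι : ℝ)⁻¹ * ∑ i, a j ⬝ᵥ x i ≤ (Fintype.card ι : ℝ)⁻¹ * ∑ _i : ι, b j :=
          mul_le_mul_of_nonneg_left (sum_le_sum fun i _ => hxP i j) (inv_nonneg.mpr hN.le)
      _ = b j := by rw [sum_const, card_univ, nsmul_eq_mul, inv_mul_cancel_left₀ hN.ne']
  have hy₀lt : ∀ j, j ∈ J' → a j ⬝ᵥ y₀ < b j := fun j hj => by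
    obtain ⟨i, hi⟩ := hJ'in j hj
    rw [hay₀]
    calc (Fintype.card ι : ℝ)⁻¹ * ∑ i, a j ⬝ᵥ x i < (Fintype.card ι : ℝ)⁻¹ * ∑ _i : ι, b j :=
          mul_lt_mul_of_pos_left (sum_lt_sum (fun i _ => hxP i j) ⟨i, mem_univ _, hi⟩)
            (inv_pos.mpr hN)
      _ = b j := by rw [sum_const, card_univ, nsmul_eq_mul, inv_mul_cancel_left₀ hN.ne']
  have hy₀eq : ∀ j, j ∉ J' → a j ⬝ᵥ y₀ = b j := fun j hj => by
    rw [hay₀, Finset.sum_congr rfl fun i _ => hJ'out j hj i, sum_const, card_univ, nsmul_eq_mul,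
      inv_mul_cancel_left₀ hN.ne']
  -- the point `w` of the segment `[y₀, z]` with `a_cᵀ w = b_c`
  have hcy₀ : a c ⬝ᵥ y₀ < b c := hy₀lt c (hTJ hcT)
  obtain ⟨s, hs⟩ : ∃ s : ℝ, s = (b c - a c ⬝ᵥ y₀) / (a c ⬝ᵥ z - a c ⬝ᵥ y₀) := ⟨_, rfl⟩
  have hden : 0 < a c ⬝ᵥ z - a c ⬝ᵥ y₀ := by linarith
  have hs0 : 0 < s := hs ▸ div_pos (by linarith) hden
  have hs1 : s < 1 := hs ▸ (div_lt_one hden).mpr (by linarith)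
  obtain ⟨w, hw⟩ : ∃ w : Fin d → ℝ, w = y₀ + s • (z - y₀) := ⟨_, rfl⟩
  have haw : ∀ j, a j ⬝ᵥ w = (1 - s) * (a j ⬝ᵥ y₀) + s * (a j ⬝ᵥ z) := fun j => by
    rw [hw, dotProduct_add, dotProduct_smul, dotProduct_sub, smul_eq_mul]; ring
  have hwc : a c ⬝ᵥ w = b c := by
    rw [haw]
    have : s * (a c ⬝ᵥ z - a c ⬝ᵥ y₀) = b c - a c ⬝ᵥ y₀ := by
      rw [hs]; exact div_mul_cancel₀ _ hden.ne'
    linarith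
  have hwT : ∀ j, j ∈ T → j ≠ c → a j ⬝ᵥ w < b j := fun j hj hjc => by
    rw [haw]
    have h1 : a j ⬝ᵥ y₀ < b j := hy₀lt j (hTJ hj)
    have h2 : a j ⬝ᵥ z ≤ b j := hzT.2 j (mem_erase.mpr ⟨hjc, hj⟩)
    nlinarith
  have hwout : ∀ j, j ∉ J' → a j ⬝ᵥ w ≤ b j := fun j hj => by
    rw [haw, hy₀eq j hj]
    have h2 : a j ⬝ᵥ z ≤ b j := hzT.1 j hj
    nlinarith
  have hwPT : w ∈ PT T := by
    refine ⟨hwout, fun j hj => ?_⟩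
    by_cases hjc : j = c
    · rw [hjc]; exact hwc.le
    · exact (hwT j hj hjc).le
  have hwP : ∀ j, a j ⬝ᵥ w ≤ b j := hTgood hwPT
  refine ⟨c, p, w, hcp, hwP, hwc, fun u hu hcu => ?_⟩
  -- following a direction `u ∈ lin(P) ∩ a_c^⊥` from `w`
  set S : ℝ := ∑ j ∈ T.erase c, |a j ⬝ᵥ u| / (b j - a j ⬝ᵥ w) with hS
  have hslack : ∀ j, j ∈ T.erase c → 0 < b j - a j ⬝ᵥ w := fun j hj => by
    have := hwT j (mem_of_mem_erase hj) (ne_of_mem_erase hj)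
    linarith
  have hS0 : 0 ≤ S := sum_nonneg fun j hj => div_nonneg (abs_nonneg _) (hslack j hj).le
  refine ⟨1 / (1 + S), by positivity, fun j => ?_⟩
  have key : w + (1 / (1 + S)) • u ∈ PT T := by
    refine ⟨fun j hj => ?_, fun j hj => ?_⟩
    · rw [dotProduct_add, dotProduct_smul,
        dotProduct_eq_zero_of_mem_vectorSpan x (hJ'out j hj) hu, smul_zero, add_zero]
      exact hwout j hj
    · by_cases hjc : j = c
      · subst hjc
        rw [dotProduct_add, dotProduct_smul, hcu, smul_zero, add_zero]
        exact hwc.le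
      · have hj' : j ∈ T.erase c := mem_erase.mpr ⟨hjc, hj⟩
        have hσ := hslack j hj'
        have hle : |a j ⬝ᵥ u| / (b j - a j ⬝ᵥ w) ≤ S :=
          single_le_sum (f := fun j => |a j ⬝ᵥ u| / (b j - a j ⬝ᵥ w))
            (fun j hj => div_nonneg (abs_nonneg _) (hslack j hj).le) hj'
        have hle' : |a j ⬝ᵥ u| ≤ (b j - a j ⬝ᵥ w) * S := by
          rw [div_le_iff₀ hσ] at hle; linarith
        rw [dotProduct_add, dotProduct_smul, smul_eq_mul]
        have h3 : 1 / (1 + S) * (a j ⬝ᵥ u) ≤ 1 / (1 + S) * ((b j - a j ⬝ᵥ w) * S) :=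
          mul_le_mul_of_nonneg_left ((le_abs_self _).trans hle') (by positivity)
        have h4 : 1 / (1 + S) * ((b j - a j ⬝ᵥ w) * S) ≤ b j - a j ⬝ᵥ w := by
          rw [div_mul_eq_mul_div, one_mul, div_le_iff₀ (by positivity)]
          nlinarith
        linarith
  exact hTgood key j

/-! ### Faces cut out by an inequality: tight points, dimension -/

/-- **A face is the convex hull of its tight points.** For a `V`/`H`-described polytope
`P = conv{x_i} = {y : a_jᵀ y ≤ b_j}` and any inequality `c` of the description, the face
`P ∩ {a_cᵀ y = b_c}` is the convex hull of the `x_i` tight at `c` (in a convex combination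
`y = Σ λ_i x_i` with `a_cᵀ y = b_c` every `x_i` with `λ_i > 0` is tight) — Ewald's proof of
II, Theorem 1.1: "`H ∩ P = conv{x_1, …, x_s}`". [cite: Ewald1996, II Thm. 1.1 (proof; held text p0032)] -/
theorem convexHull_range_tight_eq [Fintype ι] (x : ι → (Fin d → ℝ)) (a : κ → (Fin d → ℝ)) (b : κ → ℝ)
    (hP : convexHull ℝ (Set.range x) = {y | ∀ j, a j ⬝ᵥ y ≤ b j}) (c : κ) :
    convexHull ℝ (Set.range fun i : {i : ι // a c ⬝ᵥ x i = b c} => x i.1) =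
      {y | (∀ j, a j ⬝ᵥ y ≤ b j) ∧ b c ≤ a c ⬝ᵥ y} := by
  classical
  have hxP := dotProduct_le_of_convexHull_eq x a b hP
  apply Set.Subset.antisymm
  · refine convexHull_min ?_ ?_
    · rintro _ ⟨i, rfl⟩
      exact ⟨fun j => hxP i.1 j, i.2.symm.le⟩
    · intro y₁ hy₁ y₂ hy₂ α β hα hβ hαβ
      obtain ⟨h₁, h₁c⟩ := hy₁
      obtain ⟨h₂, h₂c⟩ := hy₂
      refine ⟨fun j => ?_, ?_⟩
      · rw [dotProduct_add, dotProduct_smul, dotProduct_smul, smul_eq_mul, smul_eq_mul]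
        calc α * (a j ⬝ᵥ y₁) + β * (a j ⬝ᵥ y₂) ≤ α * b j + β * b j :=
              add_le_add (mul_le_mul_of_nonneg_left (h₁ j) hα) (mul_le_mul_of_nonneg_left (h₂ j) hβ)
          _ = b j := by rw [← add_mul, hαβ, one_mul]
      · rw [dotProduct_add, dotProduct_smul, dotProduct_smul, smul_eq_mul, smul_eq_mul]
        calc b c = α * b c + β * b c := by rw [← add_mul, hαβ, one_mul]
          _ ≤ α * (a c ⬝ᵥ y₁) + β * (a c ⬝ᵥ y₂) :=
              add_le_add (mul_le_mul_of_nonneg_left h₁c hα) (mul_le_mul_of_nonneg_left h₂c hβ)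
  · rintro y ⟨hyP, hyc⟩
    have hy : y ∈ convexHull ℝ (Set.range x) := by rw [hP]; exact hyP
    obtain ⟨W, hW₀, hW₁, hWy⟩ := (mem_convexHull_range_iff_exists_fintype_weights x y).mp hy
    -- the weights of the points slack at `c` vanish
    have hnn : ∀ i, 0 ≤ W i * (b c - a c ⬝ᵥ x i) := fun i =>
      mul_nonneg (hW₀ i) (sub_nonneg.mpr (hxP i c))
    have hsum : ∑ i, W i * (b c - a c ⬝ᵥ x i) = b c - a c ⬝ᵥ y := by
      rw [← hWy, dotProduct_sum]
      simp only [dotProduct_smul, smul_eq_mul, mul_sub]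
      rw [Finset.sum_sub_distrib, ← Finset.sum_mul, hW₁, one_mul]
    have h0 : ∑ i, W i * (b c - a c ⬝ᵥ x i) = 0 :=
      le_antisymm (by rw [hsum]; linarith) (sum_nonneg fun i _ => hnn i)
    have htight : ∀ i, W i ≠ 0 → a c ⬝ᵥ x i = b c := fun i hi => by
      have := (sum_eq_zero_iff_of_nonneg fun i _ => hnn i).mp h0 i (mem_univ _)
      rcases mul_eq_zero.mp this with h | h
      · exact absurd h hi
      · linarith
    -- so `y` is a convex combination of the tight points
    refine (mem_convexHull_range_iff_exists_fintype_weights _ y).mpr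
      ⟨fun i => W i.1, fun i => hW₀ i.1, ?_, ?_⟩
    · have h1 : ∑ i ∈ univ.filter (fun i => a c ⬝ᵥ x i = b c), W i =
          ∑ i : {i : ι // a c ⬝ᵥ x i = b c}, W i.1 := Finset.sum_subtype _ (by simp) W
      rw [← h1, Finset.sum_filter_of_ne fun i _ hi => htight i hi, hW₁]
    · have h1 : ∑ i ∈ univ.filter (fun i => a c ⬝ᵥ x i = b c), W i • x i =
          ∑ i : {i : ι // a c ⬝ᵥ x i = b c}, W i.1 • x i.1 :=
        Finset.sum_subtype _ (by simp) fun i => W i • x i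
      rw [← h1, Finset.sum_filter_of_ne fun i _ hi => htight i fun h => hi (by rw [h, zero_smul]),
        hWy]

/-- The same face in pure inequality form: adjoin the reversed inequality `−a_cᵀ y ≤ −b_c` as a new
index `none : Option κ`. [folklore] -/
private theorem convexHull_range_tight_eq_option [Fintype ι] (x : ι → (Fin d → ℝ)) (a : κ → (Fin d → ℝ))
    (b : κ → ℝ) (hP : convexHull ℝ (Set.range x) = {y | ∀ j, a j ⬝ᵥ y ≤ b j}) (c : κ) :
    convexHull ℝ (Set.range fun i : {i : ι // a c ⬝ᵥ x i = b c} => x i.1) =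
      {y | ∀ j : Option κ, (j.elim (-a c) a) ⬝ᵥ y ≤ j.elim (-b c) b} := by
  rw [convexHull_range_tight_eq x a b hP c]
  ext y
  simp only [Set.mem_setOf_eq, Option.forall, Option.elim, neg_dotProduct, neg_le_neg_iff]
  exact ⟨fun h => ⟨h.2, h.1⟩, fun h => ⟨h.2, h.1⟩⟩

/-- A face cut out by an inequality that is attained in `P` has a tight point of the
`V`-description. [folklore] -/
private theorem exists_tight_of_dotProduct_eq [Fintype ι] (x : ι → (Fin d → ℝ)) (a : κ → (Fin d → ℝ))
    (b : κ → ℝ) (hP : convexHull ℝ (Set.range x) = {y | ∀ j, a j ⬝ᵥ y ≤ b j}) {c : κ}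
    {w : Fin d → ℝ} (hwP : ∀ j, a j ⬝ᵥ w ≤ b j) (hwc : a c ⬝ᵥ w = b c) : ∃ q, a c ⬝ᵥ x q = b c := by
  classical
  have hwF : w ∈ convexHull ℝ (Set.range fun i : {i : ι // a c ⬝ᵥ x i = b c} => x i.1) := by
    rw [convexHull_range_tight_eq x a b hP c]; exact ⟨hwP, hwc.symm.le⟩
  by_contra! h
  haveI : IsEmpty {i : ι // a c ⬝ᵥ x i = b c} := ⟨fun i => h i.1 i.2⟩
  rw [Set.range_eq_empty, convexHull_empty] at hwF
  exact hwF

/-- **A facet has dimension `dim P − 1`.** With `c, p, w` as in `exists_facet_inequality`, the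
direction space of the points tight at `c` has codimension one in `lin(P)`: it is annihilated by
`a_c`, contains `lin(P) ∩ a_c^⊥` (follow `u` from `w` inside the face), and `x_p − x_q`
(`q` tight) is a complementary line — Schrijver §8.4 (16): "the dimension of any facet of `P` is
one less than the dimension of `P`", for the facet of `exists_facet_inequality`.
[cite: Schrijver1986, §8.4 (16) (held text p0195)] -/
theorem finrank_vectorSpan_tight_add_one [Fintype ι] (x : ι → (Fin d → ℝ)) (a : κ → (Fin d → ℝ))
    (b : κ → ℝ) (hP : convexHull ℝ (Set.range x) = {y | ∀ j, a j ⬝ᵥ y ≤ b j}) {c : κ} {p : ι}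
    {w : Fin d → ℝ} (hcp : a c ⬝ᵥ x p < b c) (hwP : ∀ j, a j ⬝ᵥ w ≤ b j) (hwc : a c ⬝ᵥ w = b c)
    (hray : ∀ u ∈ vectorSpan ℝ (Set.range x), a c ⬝ᵥ u = 0 →
      ∃ t : ℝ, 0 < t ∧ ∀ j, a j ⬝ᵥ (w + t • u) ≤ b j) :
    Module.finrank ℝ (vectorSpan ℝ (Set.range fun i : {i : ι // a c ⬝ᵥ x i = b c} => x i.1)) + 1 =
      Module.finrank ℝ (vectorSpan ℝ (Set.range x)) := by
  classical
  set x' : {i : ι // a c ⬝ᵥ x i = b c} → (Fin d → ℝ) := fun i => x i.1 with hx'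
  set W : Submodule ℝ (Fin d → ℝ) := vectorSpan ℝ (Set.range x') with hW
  set D : Submodule ℝ (Fin d → ℝ) := vectorSpan ℝ (Set.range x) with hDdef
  have hface : convexHull ℝ (Set.range x') = {y | (∀ j, a j ⬝ᵥ y ≤ b j) ∧ b c ≤ a c ⬝ᵥ y} :=
    convexHull_range_tight_eq x a b hP c
  -- (1) `W ≤ D`
  have hWD : W ≤ D := vectorSpan_mono ℝ (by rintro _ ⟨i, rfl⟩; exact ⟨i.1, rfl⟩)
  -- (2) `a_c` annihilates `W`
  have hWc : ∀ u ∈ W, a c ⬝ᵥ u = 0 := fun u hu =>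
    dotProduct_eq_zero_of_mem_vectorSpan x' (b₀ := b c) (fun i => i.2) hu
  -- (3) `D ∩ a_c^⊥ ≤ W`
  have hwF : w ∈ convexHull ℝ (Set.range x') := by rw [hface]; exact ⟨hwP, hwc.symm.le⟩
  have hDW : ∀ u ∈ D, a c ⬝ᵥ u = 0 → u ∈ W := by
    intro u hu hcu
    obtain ⟨t, ht, htP⟩ := hray u hu hcu
    have hwtF : w + t • u ∈ convexHull ℝ (Set.range x') := by
      rw [hface]
      refine ⟨htP, ?_⟩
      rw [dotProduct_add, dotProduct_smul, hcu, smul_zero, add_zero, hwc]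
    have hmem : (w + t • u) -ᵥ w ∈ vectorSpan ℝ (convexHull ℝ (Set.range x')) :=
      vsub_mem_vectorSpan ℝ hwtF hwF
    rw [← direction_affineSpan, affineSpan_convexHull, direction_affineSpan, vsub_eq_sub,
      add_sub_cancel_left] at hmem
    exact (Submodule.smul_mem_iff W ht.ne').mp hmem
  -- (4) a transversal direction `d₀ = x_p − x_q`, `q` tight
  obtain ⟨q, hq⟩ := exists_tight_of_dotProduct_eq x a b hP hwP hwc
  obtain ⟨d₀, hd₀⟩ : ∃ d₀ : Fin d → ℝ, d₀ = x p - x q := ⟨_, rfl⟩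
  have hd₀D : d₀ ∈ D := by
    rw [hd₀, hDdef, ← vsub_eq_sub]
    exact vsub_mem_vectorSpan ℝ (Set.mem_range_self p) (Set.mem_range_self q)
  have hcd₀ : a c ⬝ᵥ d₀ ≠ 0 := by
    rw [hd₀, dotProduct_sub, hq]; exact (sub_neg.mpr hcp).ne
  have hd₀ne : d₀ ≠ 0 := fun h => hcd₀ (by rw [h, dotProduct_zero])
  have hd₀W : d₀ ∉ W := fun h => hcd₀ (hWc d₀ h)
  -- (5) `W ⊕ ℝ d₀ = D`
  have hsup : W ⊔ Submodule.span ℝ {d₀} = D := by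
    apply le_antisymm
    · exact sup_le hWD ((Submodule.span_singleton_le_iff_mem _ _).mpr hd₀D)
    · intro u hu
      obtain ⟨μ, hμ⟩ : ∃ μ : ℝ, μ = (a c ⬝ᵥ u) / (a c ⬝ᵥ d₀) := ⟨_, rfl⟩
      have h1 : u - μ • d₀ ∈ W := by
        refine hDW _ (D.sub_mem hu (D.smul_mem μ hd₀D)) ?_
        rw [dotProduct_sub, dotProduct_smul, smul_eq_mul, hμ, div_mul_cancel₀ _ hcd₀, sub_self]
      rw [Submodule.mem_sup]
      exact ⟨u - μ • d₀, h1, μ • d₀, Submodule.mem_span_singleton.mpr ⟨μ, rfl⟩, sub_add_cancel u _⟩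
  have hinf : W ⊓ Submodule.span ℝ {d₀} = ⊥ :=
    disjoint_iff.mp ((Submodule.disjoint_span_singleton' hd₀ne).mpr hd₀W)
  have key := Submodule.finrank_sup_add_finrank_inf_eq W (Submodule.span ℝ {d₀})
  rw [hsup, hinf, finrank_bot, add_zero, finrank_span_singleton hd₀ne] at key
  exact key.symm

/-! ### The triangular flag in the slack matrix -/

/-- **A full flag in the slack support.** If `P = conv{x_i} = {y : a_jᵀ y ≤ b_j}` has dimension `n`
(and, for `n = 0`, some `x_i` is slack on some inequality), there are points `x_{ρ 0},…,x_{ρ n}` and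
inequalities `γ 0,…,γ n` of the descriptions with `γ t` slack at `x_{ρ t}` and tight at `x_{ρ s}` for
all `s < t` — an `(n+1) × (n+1)` triangular pattern in the support of the slack matrix (induction on
`n` along a facet `c` of `exists_facet_inequality`: the flag of the facet, then `(x_p, c)`). This is
the support pattern behind `rank S_P ≥ n+1` and, via the psd fooling-set bound, `rank_psd S_P ≥ n+1`
(Gouveia–Robinson–Thomas 2013, proof of Prop. 3.2, `S_F' = [S_F 0; * α]` unrolled).
[cite: GouveiaRobinsonThomas2013, Prop. 3.2 (proof, p07)] -/
theorem exists_slack_triangular [Fintype ι] [Fintype κ] (n : ℕ) (x : ι → (Fin d → ℝ))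
    (a : κ → (Fin d → ℝ)) (b : κ → ℝ) (hP : convexHull ℝ (Set.range x) = {y | ∀ j, a j ⬝ᵥ y ≤ b j})
    (hn : Module.finrank ℝ (vectorSpan ℝ (Set.range x)) = n) (hS : ∃ i j, a j ⬝ᵥ x i ≠ b j) :
    ∃ (ρ : Fin (n + 1) → ι) (γ : Fin (n + 1) → κ),
      (∀ t, a (γ t) ⬝ᵥ x (ρ t) ≠ b (γ t)) ∧ ∀ s t, s < t → a (γ t) ⬝ᵥ x (ρ s) = b (γ t) := by
  induction n generalizing ι κ with
  | zero =>
    obtain ⟨i, j, h⟩ := hS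
    exact ⟨fun _ => i, fun _ => j, fun _ => h,
      fun s t hst => absurd (Fin.lt_def.mp hst) (by have := s.isLt; have := t.isLt; omega)⟩
  | succ n ih =>
    classical
    obtain ⟨c, p, w, hcp, hwP, hwc, hray⟩ := exists_facet_inequality x a b hP (by omega)
    have hdim := finrank_vectorSpan_tight_add_one x a b hP hcp hwP hwc hray
    have hP' := convexHull_range_tight_eq_option x a b hP c
    obtain ⟨q, hq⟩ := exists_tight_of_dotProduct_eq x a b hP hwP hwc
    -- the face is again nondegenerate: `x_q` is slack somewhere (else `P = {x_q}`)
    have hS' : ∃ (i : {i : ι // a c ⬝ᵥ x i = b c}) (j : Option κ),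
        (j.elim (-a c) a) ⬝ᵥ x i.1 ≠ j.elim (-b c) b := by
      by_contra! h
      have hall : ∀ j, a j ⬝ᵥ x q = b j := fun j => h ⟨q, hq⟩ (some j)
      have := eq_of_forall_slack_eq_zero x a b hP hall p
      rw [this, hq] at hcp
      exact lt_irrefl _ hcp
    obtain ⟨ρ', γ', hdiag', hoff'⟩ := ih (fun i : {i : ι // a c ⬝ᵥ x i = b c} => x i.1)
      (fun j : Option κ => j.elim (-a c) a) (fun j => j.elim (-b c) b) hP' (by omega) hS'
    -- the diagonal columns of the face flag are genuine inequalities (`none` is tight everywhere)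
    have hsome : ∀ t, ∃ j, γ' t = some j := fun t => by
      cases h : γ' t with
      | none =>
        exfalso
        apply hdiag' t
        rw [h]
        simp only [Option.elim, neg_dotProduct, (ρ' t).2]
      | some j => exact ⟨j, rfl⟩
    choose g hg using hsome
    refine ⟨Fin.snoc (fun t => (ρ' t).1) p, Fin.snoc g c, fun t => ?_, fun s t hst => ?_⟩
    · rcases Fin.eq_castSucc_or_eq_last t with ⟨t, rfl⟩ | rfl
      · simp only [Fin.snoc_castSucc]
        have := hdiag' t
        rw [hg t] at this
        simpa only [Option.elim] using this
      · simp only [Fin.snoc_last]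
        exact hcp.ne
    · rcases Fin.eq_castSucc_or_eq_last t with ⟨t, rfl⟩ | rfl
      · rcases Fin.eq_castSucc_or_eq_last s with ⟨s, rfl⟩ | rfl
        · simp only [Fin.snoc_castSucc]
          have := hoff' s t (Fin.castSucc_lt_castSucc_iff.mp hst)
          rw [hg t] at this
          simpa only [Option.elim] using this
        · exact absurd hst (not_lt.mpr (Fin.castSucc_lt_last t).le)
      · rcases Fin.eq_castSucc_or_eq_last s with ⟨s, rfl⟩ | rfl
        · simp only [Fin.snoc_castSucc, Fin.snoc_last]
          exact (ρ' s).2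
        · exact absurd hst (lt_irrefl _)

/-! ### Corollary 5.9 -/

/-- **`rank_psd S_P ≥ dim P + 1`** (Gouveia–Robinson–Thomas 2013, Prop. 3.2; FGPRT Cor. 5.9), for any
`V`/`H`-description of a polytope of dimension `n ≥ 1`: a psd factorization of the slack matrix
`(b_j − a_jᵀ x_i)` has size at least `n + 1` (the flag `exists_slack_triangular` fed to the psd
fooling-set bound `HasPsdFactorization.card_le_of_triangular`).
[cite: GouveiaRobinsonThomas2013, Prop. 3.2 (p07)] -/
theorem add_one_le_of_hasPsdFactorization_slack [Fintype ι] [Fintype κ] (x : ι → (Fin d → ℝ))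
    (a : κ → (Fin d → ℝ)) (b : κ → ℝ) (hP : convexHull ℝ (Set.range x) = {y | ∀ j, a j ⬝ᵥ y ≤ b j})
    {n : ℕ} (hn : Module.finrank ℝ (vectorSpan ℝ (Set.range x)) = n) (h1 : 1 ≤ n) {k : ℕ}
    (hk : HasPsdFactorization (fun i j => b j - a j ⬝ᵥ x i) k) : n + 1 ≤ k := by
  obtain ⟨ρ, γ, hdiag, hoff⟩ := exists_slack_triangular n x a b hP hn
    (exists_dotProduct_ne_of_finrank_ne_zero x a b hP (by omega))
  exact hk.card_le_of_triangular ρ γ (fun t => sub_ne_zero.mpr (hdiag t).symm)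
    fun s t hst => sub_eq_zero.mpr (hoff s t hst).symm

/-- **Discharge of `FawziEtAl2015_cor59`** (FGPRT Corollary 5.9 = Gouveia–Robinson–Thomas 2013,
Lemma 3.1 + Prop. 3.2): for an `n`-dimensional `V`/`H`-described polytope, `n ≥ 1`,
`rank S_P = n + 1` (`rank_pairSlackMatrix_eq_finrank_add_one`) and `rank_psd S_P ≥ n + 1`
(`add_one_le_of_hasPsdFactorization_slack`). [cite: FawziEtAl2015, Cor. 5.9 (p15)] -/
theorem FawziEtAl2015_cor59_holds : FawziEtAl2015_cor59 := by
  intro d v f n x a b hn hdim hP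
  refine ⟨rank_pairSlackMatrix_eq_finrank_add_one x a b hn hdim hP, fun k hk hfac => ?_⟩
  have := add_one_le_of_hasPsdFactorization_slack x a b hP hdim hn hfac
  omega

/-! ### Bordered matrices and faces (GRT 2013, Prop. 2.6 and Prop. 3.8) -/

/-- **GRT Proposition 2.6, lower bound** (p05–06, verbatim): "Suppose `M ∈ ℝ^{p×q}_+` and
`rank_psd M = k`. If `M` is extended to `M' = [M 0; w α]` where `w ∈ ℝ^q_+`, `α > 0` and `0` is a
column of zeros, then `rank_psd M' = k+1`." Typed (the inequality `rank_psd M' ≥ rank_psd M + 1`, for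
a sub-pattern): if `M` has a psd factorization of size `k`, a column `c` vanishes on the rows
satisfying `r` and is nonzero at the row `p`, then the rows satisfying `r` have a psd factorization
of size `≤ k − 1`. Proof: the tree's block bound `FawziEtAl2015_thm210_holds`
(`rank_psd [P 0; Q R] ≥ rank_psd P + rank_psd R`) on the blocks `P = M[r, ≠ c]`, `R = (M p c)`.
[cite: GouveiaRobinsonThomas2013, Prop. 2.6 (p05–p06)] -/
theorem HasPsdFactorization.exists_lt_of_bordered {ι κ : Type} [Finite ι] [Finite κ]
    {M : ι → κ → ℝ} {k : ℕ} (h : HasPsdFactorization M k) (r : ι → Prop) (p : ι) (c : κ)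
    (hpc : M p c ≠ 0) (hrc : ∀ i, r i → M i c = 0) :
    ∃ k', k' + 1 ≤ k ∧ HasPsdFactorization (fun (i : {i // r i}) j => M i.1 j) k' := by
  classical
  -- the bordered submatrix `[M[r, ≠c] 0; M[p, ≠c] M[p,c]]`
  have hblock : HasPsdFactorization (Matrix.fromBlocks
      (Matrix.of fun (i : {i // r i}) (j : {j // j ≠ c}) => M i.1 j.1) 0
      (Matrix.of fun (_ : Unit) (j : {j // j ≠ c}) => M p j.1)
      (Matrix.of fun (_ : Unit) (_ : Unit) => M p c)) k := by
    have e : Matrix.fromBlocks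
        (Matrix.of fun (i : {i // r i}) (j : {j // j ≠ c}) => M i.1 j.1) 0
        (Matrix.of fun (_ : Unit) (j : {j // j ≠ c}) => M p j.1)
        (Matrix.of fun (_ : Unit) (_ : Unit) => M p c) =
        fun i j => M (Sum.elim (fun i : {i // r i} => i.1) (fun _ => p) i)
          (Sum.elim (fun j : {j // j ≠ c} => j.1) (fun _ => c) j) := by
      ext (i | i) (j | j)
      · rfl
      · simp [hrc i.1 i.2]
      · rfl
      · rfl
    rw [e]
    exact h.submatrix _ _
  obtain ⟨k₁, k₂, hk, hP, hR⟩ := FawziEtAl2015_thm210_holds _ _ _ _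
    (fun (i : {i // r i}) (j : {j // j ≠ c}) => M i.1 j.1) (fun (_ : Unit) (j : {j // j ≠ c}) => M p j.1)
    (fun (_ : Unit) (_ : Unit) => M p c) k hblock
  have hk₂ : 1 ≤ k₂ := by
    by_contra h0
    obtain rfl : k₂ = 0 := by omega
    exact hpc (hasPsdFactorization_zero_iff.mp hR () ())
  obtain ⟨A, B, hA, hB, hM⟩ := hP
  refine ⟨k₁, by omega, A, fun j => if hj : j = c then 0 else B ⟨j, hj⟩, hA, fun j => ?_,
    fun i j => ?_⟩
  · by_cases hj : j = c
    · simp only [hj, dite_true]; exact PosSemidef.zero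
    · simp only [hj, dite_false]; exact hB _
  · by_cases hj : j = c
    · subst hj
      simp only [dite_true, Matrix.mul_zero, trace_zero]
      exact hrc i.1 i.2
    · simp only [hj, dite_false]
      exact hM i ⟨j, hj⟩

/-- **GRT Proposition 3.8** (p09, verbatim): "If a polytope `P` has a facet of psd rank `k`, then `P`
has psd rank at least `k+1`." Typed for slack matrices `(b_j − a_jᵀ x_i)` of a `V`/`H` pair: for an
inequality `c` slack at some point `x_p`, the slack matrix of the points tight at `c` (the `V`/`H`
description of the face `a_c = b_c`, cf. `convexHull_range_tight_eq`; for a facet-defining `c` this is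
the facet's slack matrix up to zero and repeated columns) has a psd factorization of size one less.
[cite: GouveiaRobinsonThomas2013, Prop. 3.8 (p09)] -/
theorem exists_hasPsdFactorization_tight_of_slack {ι κ : Type} [Finite ι] [Finite κ]
    (x : ι → (Fin d → ℝ)) (a : κ → (Fin d → ℝ)) (b : κ → ℝ) {c : κ} {p : ι}
    (hcp : a c ⬝ᵥ x p ≠ b c) {k : ℕ} (hk : HasPsdFactorization (fun i j => b j - a j ⬝ᵥ x i) k) :
    ∃ k', k' + 1 ≤ k ∧
      HasPsdFactorization (fun (i : {i : ι // a c ⬝ᵥ x i = b c}) j => b j - a j ⬝ᵥ x i.1) k' :=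
  hk.exists_lt_of_bordered (fun i => a c ⬝ᵥ x i = b c) p c (sub_ne_zero.mpr hcp.symm)
    fun _ hi => sub_eq_zero.mpr hi.symm

/-! ### 2-level polytopes have psd rank exactly `dim P + 1` (GRT 2013, Cor. 4.2) -/

/-- **GRT Corollary 4.2, first statement** (p10, verbatim): "Let `P` be an `n`-dimensional `2`-level
polytope in `ℝⁿ`. Then the psd rank of `P` is exactly `n+1`", where (Definition 4.1) "`P` is said to
be `2`-level if it has a slack matrix all of whose entries are zero or one". Typed for a
`V`/`H`-described polytope `conv{x_i} = {y : a_jᵀ y ≤ b_j}` of dimension `n ≥ 1` whose slack matrix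
`(b_j − a_jᵀ x_i)` is `0/1`: it has a psd factorization of size `n + 1` (the `0/1` matrix is its own
Hadamard square root, `hasPsdFactorization_rank_of_zero_one`, and `rank S_P = n + 1`,
`rank_pairSlackMatrix_eq_finrank_add_one`) and none of size `≤ n`
(`add_one_le_of_hasPsdFactorization_slack`). The second statement of Cor. 4.2 (all factors of a
`S^{n+1}_+`-factorization have rank one) is not typed here.
[cite: GouveiaRobinsonThomas2013, Def. 4.1 and Cor. 4.2 (p10)] -/
theorem hasPsdFactorization_iff_of_twoLevel {d v f n : ℕ} (x : Fin v → (Fin d → ℝ))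
    (a : Fin f → (Fin d → ℝ)) (b : Fin f → ℝ) (hn : 1 ≤ n)
    (hdim : Module.finrank ℝ (vectorSpan ℝ (Set.range x)) = n)
    (hP : convexHull ℝ (Set.range x) = {y | ∀ j, a j ⬝ᵥ y ≤ b j})
    (h01 : ∀ i j, b j - a j ⬝ᵥ x i = 0 ∨ b j - a j ⬝ᵥ x i = 1) (k : ℕ) :
    HasPsdFactorization (fun i j => b j - a j ⬝ᵥ x i) k ↔ n + 1 ≤ k := by
  constructor
  · exact fun hk => add_one_le_of_hasPsdFactorization_slack x a b hP hdim hn hk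
  · intro hk
    have hrank : (Matrix.of fun i j => b j - a j ⬝ᵥ x i).rank = n + 1 :=
      rank_pairSlackMatrix_eq_finrank_add_one x a b hn hdim hP
    have h := hasPsdFactorization_rank_of_zero_one (Matrix.of fun i j => b j - a j ⬝ᵥ x i)
      fun i j => h01 i j
    rw [hrank] at h
    exact h.mono hk

/-! ### Example 3.5: the square has psd rank exactly `3` -/


/-- Intersections of closed half-spaces are convex. [folklore] -/
private theorem convex_setOf_forall_dotProduct_le {d : ℕ} {κ : Type*} (a : κ → (Fin d → ℝ))
    (b : κ → ℝ) : Convex ℝ {y : Fin d → ℝ | ∀ j, a j ⬝ᵥ y ≤ b j} := by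
  intro y₁ hy₁ y₂ hy₂ α β hα hβ hαβ j
  rw [dotProduct_add, dotProduct_smul, dotProduct_smul, smul_eq_mul, smul_eq_mul]
  calc α * (a j ⬝ᵥ y₁) + β * (a j ⬝ᵥ y₂) ≤ α * b j + β * b j :=
        add_le_add (mul_le_mul_of_nonneg_left (hy₁ j) hα) (mul_le_mul_of_nonneg_left (hy₂ j) hβ)
    _ = b j := by rw [← add_mul, hαβ, one_mul]

/-- **FGPRT Example 3.5** (p10): the slack matrix of the square `[−1,1]²`,
`M = [1 1 0 0; 0 1 1 0; 0 0 1 1; 1 0 0 1]`, has "`rank_psd M ≤ 3`" (the printed rank-one factorization;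
here: `M` is `0/1` of rank `3`) and "no smaller representation of the square `[−1,1]²` is possible: it
was proved in [GRT 2013] that the psd rank of any `n`-dimensional polytope is at least `n+1` which in
this case means that `rank_psd M ≥ 2+1 = 3`". PROVED: `M` is the slack matrix of the `V`/`H` pair
`{(−1,−1),(1,−1),(1,1),(−1,1)}`, `{(1−y₁)/2, (1−y₂)/2, (1+y₁)/2, (1+y₂)/2 ≥ 0}` of the 2-dimensional,
2-level square, so `hasPsdFactorization_iff_of_twoLevel` applies. [cite: FawziEtAl2015, Ex. 3.5 (p10)] -/
theorem FawziEtAl2015_ex35 (k : ℕ) :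
    HasPsdFactorization (fun i j : Fin 4 =>
      (!![1, 1, 0, 0; 0, 1, 1, 0; 0, 0, 1, 1; 1, 0, 0, 1] : Matrix (Fin 4) (Fin 4) ℝ) i j) k ↔ 3 ≤ k := by
  -- the `V`/`H` description of the square behind `M`
  let x : Fin 4 → (Fin 2 → ℝ) := ![![-1, -1], ![1, -1], ![1, 1], ![-1, 1]]
  let a : Fin 4 → (Fin 2 → ℝ) := ![![1 / 2, 0], ![0, 1 / 2], ![-1 / 2, 0], ![0, -1 / 2]]
  let b : Fin 4 → ℝ := fun _ => 1 / 2
  have hM : (fun i j : Fin 4 =>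
      (!![1, 1, 0, 0; 0, 1, 1, 0; 0, 0, 1, 1; 1, 0, 0, 1] : Matrix (Fin 4) (Fin 4) ℝ) i j) =
      fun i j => b j - a j ⬝ᵥ x i := by
    funext i j
    fin_cases i <;> fin_cases j <;> simp [x, a, b] <;> norm_num
  have h01 : ∀ i j, b j - a j ⬝ᵥ x i = 0 ∨ b j - a j ⬝ᵥ x i = 1 := by
    intro i j
    fin_cases i <;> fin_cases j <;> simp [x, a, b] <;> norm_num
  -- `conv{x_i} = [−1,1]²`
  have hbox : ∀ y : Fin 2 → ℝ, (∀ j, a j ⬝ᵥ y ≤ b j) ↔ (-1 ≤ y 0 ∧ y 0 ≤ 1) ∧ (-1 ≤ y 1 ∧ y 1 ≤ 1) := by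
    intro y
    have e : ∀ j, a j ⬝ᵥ y = a j 0 * y 0 + a j 1 * y 1 := fun j => Matrix.vec2_dotProduct _ _
    simp only [Fin.forall_fin_succ, IsEmpty.forall_iff, and_true, e, a, b, Matrix.cons_val_zero,
      Matrix.cons_val_one, Matrix.cons_val_succ, Matrix.cons_val_fin_one]
    constructor
    · rintro ⟨h0, h1, h2, h3⟩; refine ⟨⟨?_, ?_⟩, ?_, ?_⟩ <;> linarith
    · rintro ⟨⟨h0, h1⟩, h2, h3⟩; refine ⟨?_, ?_, ?_, ?_⟩ <;> linarith
  have hP : convexHull ℝ (Set.range x) = {y | ∀ j, a j ⬝ᵥ y ≤ b j} := by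
    apply Set.Subset.antisymm
    · refine convexHull_min ?_ (convex_setOf_forall_dotProduct_le a b)
      rintro _ ⟨i, rfl⟩
      rw [Set.mem_setOf_eq, hbox]
      fin_cases i <;> simp [x]
    · intro y hy
      rw [Set.mem_setOf_eq, hbox] at hy
      obtain ⟨⟨h0, h0'⟩, h1, h1'⟩ := hy
      refine (mem_convexHull_range_iff_exists_fintype_weights x y).mpr
        ⟨![(1 - y 0) * (1 - y 1) / 4, (1 + y 0) * (1 - y 1) / 4, (1 + y 0) * (1 + y 1) / 4,
          (1 - y 0) * (1 + y 1) / 4], ?_, ?_, ?_⟩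
      · intro i
        fin_cases i <;> simp <;> nlinarith
      · simp [Fin.sum_univ_four]; ring
      · ext t
        fin_cases t <;> simp [Fin.sum_univ_four, x] <;> ring
  -- `dim = 2`
  have hdim : Module.finrank ℝ (vectorSpan ℝ (Set.range x)) = 2 := by
    have htop : vectorSpan ℝ (Set.range x) = ⊤ := by
      rw [eq_top_iff]
      rintro v -
      have h1 : x 1 -ᵥ x 0 ∈ vectorSpan ℝ (Set.range x) :=
        vsub_mem_vectorSpan ℝ (Set.mem_range_self _) (Set.mem_range_self _)
      have h3 : x 3 -ᵥ x 0 ∈ vectorSpan ℝ (Set.range x) :=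
        vsub_mem_vectorSpan ℝ (Set.mem_range_self _) (Set.mem_range_self _)
      have hv : v = (v 0 / 2) • (x 1 -ᵥ x 0) + (v 1 / 2) • (x 3 -ᵥ x 0) := by
        ext t
        fin_cases t <;> simp [x] <;> ring
      rw [hv]
      exact Submodule.add_mem _ (Submodule.smul_mem _ _ h1) (Submodule.smul_mem _ _ h3)
    rw [htop, finrank_top, Module.finrank_fin_fun]
  rw [hM]
  exact hasPsdFactorization_iff_of_twoLevel x a b (by norm_num) hdim hP h01 k

/-! ### Descriptions with equalities -/

/-- **Corollary 5.9 for `H`-descriptions with equalities.** Combinatorial polytopes are usually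
described as `{y : a_jᵀ y ≤ b_j (j ∈ κ), c_lᵀ y = e_l (l ∈ κ')}` (e.g. degree equations); the
equality rows of the slack matrix vanish identically, so the bound `rank_psd ≥ dim P + 1` of
`add_one_le_of_hasPsdFactorization_slack` (GRT Prop. 3.2 / FGPRT Cor. 5.9, stated for pure inequality
descriptions — split each equality into two inequalities) already holds for the slack matrix
`(b_j − a_jᵀ x_i)` of the INEQUALITY rows alone. [cite: GouveiaRobinsonThomas2013, Prop. 3.2 (p07)] -/
theorem add_one_le_of_hasPsdFactorization_slack_of_eq {ι κ κ' : Type*} [Fintype ι] [Fintype κ]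
    [Fintype κ'] (x : ι → (Fin d → ℝ)) (a : κ → (Fin d → ℝ)) (b : κ → ℝ) (c : κ' → (Fin d → ℝ))
    (e : κ' → ℝ)
    (hP : convexHull ℝ (Set.range x) = {y | (∀ j, a j ⬝ᵥ y ≤ b j) ∧ ∀ l, c l ⬝ᵥ y = e l})
    {n : ℕ} (hn : Module.finrank ℝ (vectorSpan ℝ (Set.range x)) = n) (h1 : 1 ≤ n) {k : ℕ}
    (hk : HasPsdFactorization (fun i j => b j - a j ⬝ᵥ x i) k) : n + 1 ≤ k := by
  classical
  -- the pure-inequality description: each equality as two inequalities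
  let a' : κ ⊕ (κ' ⊕ κ') → (Fin d → ℝ) := Sum.elim a (Sum.elim c fun l => -c l)
  let b' : κ ⊕ (κ' ⊕ κ') → ℝ := Sum.elim b (Sum.elim e fun l => -e l)
  have hP' : convexHull ℝ (Set.range x) = {y | ∀ j, a' j ⬝ᵥ y ≤ b' j} := by
    rw [hP]
    ext y
    simp only [Set.mem_setOf_eq, Sum.forall, a', b', Sum.elim_inl, Sum.elim_inr, neg_dotProduct,
      neg_le_neg_iff]
    constructor
    · rintro ⟨h₁, h₂⟩
      exact ⟨h₁, fun l => (h₂ l).le, fun l => (h₂ l).ge⟩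
    · rintro ⟨h₁, h₂, h₃⟩
      exact ⟨h₁, fun l => le_antisymm (h₂ l) (h₃ l)⟩
  -- the points `x_i` satisfy the equalities, so the new columns of the slack matrix vanish
  have hxeq : ∀ i l, c l ⬝ᵥ x i = e l := fun i => by
    have hi : x i ∈ {y : Fin d → ℝ | (∀ j, a j ⬝ᵥ y ≤ b j) ∧ ∀ l, c l ⬝ᵥ y = e l} := by
      rw [← hP]; exact subset_convexHull ℝ _ (Set.mem_range_self i)
    exact hi.2
  have hk' : HasPsdFactorization (fun i j => b' j - a' j ⬝ᵥ x i) k := by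
    obtain ⟨A, B, hA, hB, hM⟩ := hk
    refine ⟨A, Sum.elim B fun _ => 0, hA, ?_, ?_⟩
    · rintro (j | j)
      · exact hB j
      · exact PosSemidef.zero
    · rintro i (j | (l | l))
      · exact hM i j
      · simp [a', b', hxeq i l]
      · simp [a', b', neg_dotProduct, hxeq i l]
  exact add_one_le_of_hasPsdFactorization_slack x a' b' hP' hn h1 hk'

section Cor513

variable {n : ℕ}

/-! #### Restricting an `n`-variate polynomial to a line `t ↦ q + t d` -/

/-- Evaluation of the restriction `P(q + t d)` (as a univariate polynomial in `t`). [folklore] -/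
private theorem eval_aeval_line (P : MvPolynomial (Fin n) ℝ) (q d : Fin n → ℝ) (t : ℝ) :
    Polynomial.eval t (MvPolynomial.aeval
      (fun i => Polynomial.C (d i) * Polynomial.X + Polynomial.C (q i)) P) =
      MvPolynomial.eval (q + t • d) P := by
  induction P using MvPolynomial.induction_on with
  | C a => simp
  | add p p' hp hp' => simp [hp, hp']
  | mul_X p i hp =>
      rw [map_mul, map_mul, MvPolynomial.aeval_X, Polynomial.eval_mul, hp, MvPolynomial.eval_X]
      simp only [Polynomial.eval_add, Polynomial.eval_mul, Polynomial.eval_C, Polynomial.eval_X,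
        Pi.add_apply, Pi.smul_apply, smul_eq_mul]
      ring

/-- The restriction to a line has degree at most the total degree. [folklore] -/
private theorem natDegree_aeval_line_le (P : MvPolynomial (Fin n) ℝ) (q d : Fin n → ℝ) :
    (MvPolynomial.aeval (fun i => Polynomial.C (d i) * Polynomial.X + Polynomial.C (q i)) P).natDegree
      ≤ P.totalDegree := by
  classical
  conv_lhs => rw [MvPolynomial.as_sum P]
  rw [map_sum]
  refine Polynomial.natDegree_sum_le_of_forall_le _ _ fun s hs => ?_
  rw [MvPolynomial.aeval_monomial, Polynomial.algebraMap_eq]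
  refine Polynomial.natDegree_C_mul_le _ _ |>.trans ?_
  refine (MvPolynomial.le_totalDegree hs).trans' ?_
  show (∏ i ∈ s.support, (Polynomial.C (d i) * Polynomial.X + Polynomial.C (q i)) ^ s i).natDegree ≤
    ∑ i ∈ s.support, s i
  refine Polynomial.natDegree_prod_le _ _ |>.trans (Finset.sum_le_sum fun i _ => ?_)
  refine Polynomial.natDegree_pow_le.trans ?_
  have := Polynomial.natDegree_linear_le (a := d i) (b := q i)
  calc s i * (Polynomial.C (d i) * Polynomial.X + Polynomial.C (q i)).natDegree ≤ s i * 1 :=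
        Nat.mul_le_mul_left _ this
    _ = s i := mul_one _

/-- A polynomial vanishing on a line near a point vanishes on the whole line. [folklore] -/
private theorem eval_line_eq_zero_of_nhds (P : MvPolynomial (Fin n) ℝ) (q d : Fin n → ℝ)
    (h : ∀ᶠ t in nhds (0 : ℝ), MvPolynomial.eval (q + t • d) P = 0) (t : ℝ) :
    MvPolynomial.eval (q + t • d) P = 0 := by
  obtain ⟨ε, hε, hball⟩ := Metric.eventually_nhds_iff.mp h
  set g := MvPolynomial.aeval (fun i => Polynomial.C (d i) * Polynomial.X + Polynomial.C (q i)) P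
  have hg : g = 0 := by
    refine Polynomial.eq_zero_of_infinite_isRoot g ((Set.Ioo_infinite (neg_lt_self hε)).mono ?_)
    intro s hs
    rw [Set.mem_setOf_eq, Polynomial.IsRoot.def, eval_aeval_line]
    refine hball ?_
    rw [Real.dist_eq, sub_zero, abs_lt]
    exact hs
  rw [← eval_aeval_line]
  change Polynomial.eval t g = 0
  rw [hg, Polynomial.eval_zero]

/-- Root counting on a line: if `P(q) ≠ 0` and `P` vanishes at `q + t d` for all `t` in a finite set `T`,
then `|T| ≤ deg P`. [folklore] -/
private theorem card_le_totalDegree_of_eval_line_eq_zero (P : MvPolynomial (Fin n) ℝ)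
    (q d : Fin n → ℝ) (hq : MvPolynomial.eval q P ≠ 0) (T : Finset ℝ)
    (hT : ∀ t ∈ T, MvPolynomial.eval (q + t • d) P = 0) : T.card ≤ P.totalDegree := by
  classical
  set g := MvPolynomial.aeval (fun i => Polynomial.C (d i) * Polynomial.X + Polynomial.C (q i)) P
  have hg : g ≠ 0 := fun h0 => by
    have := eval_aeval_line P q d 0
    rw [zero_smul, add_zero] at this
    exact hq (by rw [← this]; simp [g, h0])
  refine le_trans ?_ (natDegree_aeval_line_le P q d)
  refine le_trans ?_ (Polynomial.card_roots' g)
  rw [← Finset.card_val]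
  refine Multiset.card_le_card (Finset.val_le_iff_val_subset.mpr fun t ht => ?_)
  rw [Polynomial.mem_roots hg, Polynomial.IsRoot.def, eval_aeval_line]
  exact hT t (by simpa using ht)

/-- Avoiding finitely many hyperplanes through the origin: for nonzero `w_l` there is a direction `e`
with `w_l · e ≠ 0` for all `l` (moment curve + root counting). [folklore] -/
private theorem exists_dotProduct_ne_zero_of_finite {L : Type*} [Finite L] (w : L → (Fin n → ℝ))
    (hw : ∀ l, w l ≠ 0) : ∃ e : Fin n → ℝ, ∀ l, w l ⬝ᵥ e ≠ 0 := by
  classical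
  haveI := Fintype.ofFinite L
  -- the polynomials `s ↦ w_l · (1, s, s², …)`
  let g : L → Polynomial ℝ := fun l => ∑ i : Fin n, Polynomial.C (w l i) * Polynomial.X ^ (i : ℕ)
  have hg : ∀ l, g l ≠ 0 := fun l h0 => by
    apply hw l
    funext i
    have := congrArg (fun p : Polynomial ℝ => p.coeff i) h0
    simp only [g, Polynomial.finsetSum_coeff, Polynomial.coeff_C_mul, Polynomial.coeff_X_pow,
      mul_ite, mul_one, mul_zero, Polynomial.coeff_zero] at this
    rw [Finset.sum_eq_single i (fun j _ hj => if_neg (fun h => hj (Fin.ext h).symm))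
      (fun h => absurd (Finset.mem_univ i) h), if_pos rfl] at this
    exact this
  -- finitely many bad parameters
  have hfin : Set.Finite {s : ℝ | ∃ l, (g l).IsRoot s} := by
    have : {s : ℝ | ∃ l, (g l).IsRoot s} = ⋃ l, {s | (g l).IsRoot s} := by ext s; simp
    rw [this]
    exact Set.finite_iUnion fun l => Polynomial.finite_setOf_isRoot (hg l)
  obtain ⟨s, -, hs⟩ := (Set.infinite_univ (α := ℝ)).exists_notMem_finite hfin
  refine ⟨fun i => s ^ (i : ℕ), fun l h0 => hs ⟨l, ?_⟩⟩
  rw [Polynomial.IsRoot.def, Polynomial.eval_finsetSum]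
  simp only [Polynomial.eval_mul, Polynomial.eval_C, Polynomial.eval_pow, Polynomial.eval_X]
  rw [← h0, dotProduct]

/-- A hyperplane `{y | a·y = b}` is convex. [folklore] -/
private theorem convex_setOf_dotProduct_eq (a₀ : Fin n → ℝ) (b₀ : ℝ) :
    Convex ℝ {y : Fin n → ℝ | a₀ ⬝ᵥ y = b₀} := by
  intro y hy z hz α β _ _ hαβ
  simp only [Set.mem_setOf_eq] at hy hz ⊢
  rw [dotProduct_add, dotProduct_smul, dotProduct_smul, hy, hz, smul_eq_mul, smul_eq_mul, ← add_mul,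
    hαβ, one_mul]

/-- **The number of facets is at most the degree of any polynomial vanishing on the boundary**
("the degree of `C` is equal to the number of facets", p16 — the geometric step of Corollary 5.13,
isolated so that it applies to any degree bound): if `C = conv{x_i} = {y : a_j·y ≤ b_j, j < f}` is
full-dimensional with an IRREDUNDANT description and `P ≠ 0` vanishes on the boundary of `C`, then
`f ≤ deg P`: `P` vanishes on a relatively open piece of each facet hyperplane, hence (restricting to
lines, `Polynomial.eq_zero_of_infinite_isRoot`) on each of the `f` distinct hyperplanes, and a
generic line through a point where `P ≠ 0` meets them in `f` distinct parameters.
[cite: FawziEtAl2015, Cor. 5.13 (p16)] -/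
theorem card_facets_le_totalDegree_of_eval_frontier_eq_zero {v f : ℕ} (x : Fin v → (Fin n → ℝ))
    (a : Fin f → (Fin n → ℝ)) (b : Fin f → ℝ)
    (hint : (interior (convexHull ℝ (Set.range x))).Nonempty)
    (hVH : convexHull ℝ (Set.range x) = {y | ∀ j, a j ⬝ᵥ y ≤ b j})
    (hirr : ∀ j₀, {y : Fin n → ℝ | ∀ j, j ≠ j₀ → a j ⬝ᵥ y ≤ b j} ≠ {y | ∀ j, a j ⬝ᵥ y ≤ b j})
    {P : MvPolynomial (Fin n) ℝ} (hP0 : P ≠ 0)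
    (hPfr : ∀ y ∈ frontier (convexHull ℝ (Set.range x)), MvPolynomial.eval y P = 0) :
    f ≤ P.totalDegree := by
  classical
  obtain ⟨p, hp⟩ := hint
  have hmemQ : ∀ y, y ∈ convexHull ℝ (Set.range x) ↔ ∀ j, a j ⬝ᵥ y ≤ b j := fun y => by
    rw [hVH]; rfl
  have hpQ : ∀ j, a j ⬝ᵥ p ≤ b j := (hmemQ p).mp (interior_subset hp)
  -- interior points satisfy every inequality with `a_j ≠ 0` strictly
  have hstrict : ∀ w ∈ interior (convexHull ℝ (Set.range x)), ∀ j, a j ≠ 0 → a j ⬝ᵥ w < b j := by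
    intro w hw j hj
    have hcont : Continuous fun t : ℝ => w + t • a j :=
      continuous_const.add (continuous_id.smul continuous_const)
    have hev : ∀ᶠ t in nhds (0 : ℝ), w + t • a j ∈ convexHull ℝ (Set.range x) := by
      have h0 : convexHull ℝ (Set.range x) ∈ nhds (w + (0 : ℝ) • a j) := by
        rw [zero_smul, add_zero]; exact mem_interior_iff_mem_nhds.mp hw
      exact hcont.continuousAt.preimage_mem_nhds h0
    obtain ⟨t, htC, ht⟩ :=
      ((hev.filter_mono nhdsWithin_le_nhds).and (eventually_mem_nhdsWithin (s := Set.Ioi 0))).exists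
    have h1 : a j ⬝ᵥ (w + t • a j) ≤ b j := (hmemQ _).mp htC j
    rw [dotProduct_add, dotProduct_smul, smul_eq_mul] at h1
    have h2 : 0 < a j ⬝ᵥ a j :=
      lt_of_le_of_ne (Finset.sum_nonneg fun i _ => mul_self_nonneg _)
        (Ne.symm (mt dotProduct_self_eq_zero.mp hj))
    have ht0 : (0 : ℝ) < t := ht
    nlinarith [mul_pos ht0 h2]
  -- irredundancy: no `a_j` vanishes
  have ha0 : ∀ j, a j ≠ 0 := by
    intro j hj
    apply hirr j
    ext y
    simp only [Set.mem_setOf_eq]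
    refine ⟨fun hy i => ?_, fun hy i _ => hy i⟩
    by_cases hij : i = j
    · subst hij
      have := hpQ i
      rw [hj, zero_dotProduct] at this ⊢
      exact this
    · exact hy i hij
  have hpstrict : ∀ j, a j ⬝ᵥ p < b j := fun j => hstrict p hp j (ha0 j)
  -- the trivial case `f = 0`
  rcases Nat.eq_zero_or_pos f with hf0 | hf
  · subst hf0
    exact Nat.zero_le _
  -- a point in the relative interior of each facet
  have hfacet : ∀ j, ∃ y : Fin n → ℝ, a j ⬝ᵥ y = b j ∧ ∀ i, i ≠ j → a i ⬝ᵥ y < b i := by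
    intro j
    obtain ⟨z, hz, hzj⟩ : ∃ z : Fin n → ℝ, (∀ i, i ≠ j → a i ⬝ᵥ z ≤ b i) ∧ b j < a j ⬝ᵥ z := by
      by_contra hcon
      push Not at hcon
      apply hirr j
      ext y
      simp only [Set.mem_setOf_eq]
      refine ⟨fun hy i => ?_, fun hy i _ => hy i⟩
      by_cases hij : i = j
      · subst hij; exact hcon y hy
      · exact hy i hij
    have hden : 0 < a j ⬝ᵥ z - a j ⬝ᵥ p := by linarith [hpstrict j]
    set s : ℝ := (b j - a j ⬝ᵥ p) / (a j ⬝ᵥ z - a j ⬝ᵥ p) with hs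
    have hs0 : 0 < s := div_pos (by linarith [hpstrict j]) hden
    have hs1 : s < 1 := (div_lt_one hden).mpr (by linarith)
    refine ⟨p + s • (z - p), ?_, fun i hij => ?_⟩
    · rw [dotProduct_add, dotProduct_smul, dotProduct_sub, smul_eq_mul, hs, div_mul_cancel₀ _ hden.ne']
      ring
    · rw [dotProduct_add, dotProduct_smul, dotProduct_sub, smul_eq_mul]
      have h1 := hpstrict i
      have h2 := hz i hij
      nlinarith [mul_pos (sub_pos.mpr hs1) (sub_pos.mpr h1), mul_nonneg hs0.le (sub_nonneg.mpr h2)]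
  -- `P` vanishes on every facet hyperplane
  have hPH : ∀ j z, a j ⬝ᵥ z = b j → MvPolynomial.eval z P = 0 := by
    intro j z hz
    obtain ⟨y, hyj, hylt⟩ := hfacet j
    have key := eval_line_eq_zero_of_nhds P y (z - y) ?_ 1
    · simpa using key
    have hev : ∀ᶠ t in nhds (0 : ℝ), ∀ i, i ≠ j → a i ⬝ᵥ (y + t • (z - y)) < b i := by
      refine Filter.eventually_all.mpr fun i => ?_
      by_cases hij : i = j
      · exact Filter.Eventually.of_forall fun t h => absurd hij h
      · have hcont : ContinuousAt (fun t : ℝ => a i ⬝ᵥ y + t * (a i ⬝ᵥ (z - y))) 0 :=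
          (continuous_const.add (continuous_id.mul continuous_const)).continuousAt
        have h0 : (fun t : ℝ => a i ⬝ᵥ y + t * (a i ⬝ᵥ (z - y))) 0 < b i := by
          simpa using hylt i hij
        refine (hcont.eventually_lt continuousAt_const h0).mono fun t ht _ => ?_
        rw [dotProduct_add, dotProduct_smul, smul_eq_mul]
        exact ht
    refine hev.mono fun t ht => hPfr _ ?_
    have htj : a j ⬝ᵥ (y + t • (z - y)) = b j := by
      rw [dotProduct_add, dotProduct_smul, dotProduct_sub, hyj, hz, smul_eq_mul]; ring
    refine ⟨subset_closure ((hmemQ _).mpr fun i => ?_), fun hint' => ?_⟩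
    · by_cases hij : i = j
      · subst hij; exact htj.le
      · exact (ht i hij).le
    · exact absurd htj (ne_of_lt (hstrict _ hint' j (ha0 j)))
  -- a base point with `P ≠ 0` off all facet hyperplanes
  obtain ⟨q₁, hq₁⟩ : ∃ q₁ : Fin n → ℝ, MvPolynomial.eval q₁ P ≠ 0 := by
    by_contra hcon
    push Not at hcon
    exact hP0 (MvPolynomial.funext fun y => by rw [hcon, map_zero])
  obtain ⟨e₁, he₁⟩ := exists_dotProduct_ne_zero_of_finite a ha0
  have hcont₁ : Continuous fun t : ℝ => MvPolynomial.eval (q₁ + t • e₁) P :=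
    (MvPolynomial.continuous_eval P).comp (continuous_const.add (continuous_id.smul continuous_const))
  have hev₁ : ∀ᶠ t in nhds (0 : ℝ), MvPolynomial.eval (q₁ + t • e₁) P ≠ 0 :=
    hcont₁.continuousAt.eventually_ne (by simpa using hq₁)
  obtain ⟨ε₁, hε₁, hball₁⟩ := Metric.eventually_nhds_iff.mp hev₁
  obtain ⟨t₁, ht₁, ht₁bad⟩ := (Set.Ioo_infinite (neg_lt_self hε₁)).exists_notMem_finite
    (Set.finite_range fun j => (b j - a j ⬝ᵥ q₁) / (a j ⬝ᵥ e₁))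
  set q₀ : Fin n → ℝ := q₁ + t₁ • e₁ with hq₀
  have hq₀P : MvPolynomial.eval q₀ P ≠ 0 :=
    hball₁ (by rw [Real.dist_eq, sub_zero, abs_lt]; exact ht₁)
  have hq₀H : ∀ j, a j ⬝ᵥ q₀ ≠ b j := fun j hj => ht₁bad ⟨j, by
    rw [hq₀, dotProduct_add, dotProduct_smul, smul_eq_mul] at hj
    show (b j - a j ⬝ᵥ q₁) / (a j ⬝ᵥ e₁) = t₁
    rw [div_eq_iff (he₁ j)]
    linarith⟩
  -- distinct facet hyperplanes: the vectors `v_{jj'}` are nonzero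
  let vv : Fin f × Fin f → (Fin n → ℝ) := fun jj =>
    (b jj.1 - a jj.1 ⬝ᵥ q₀) • a jj.2 - (b jj.2 - a jj.2 ⬝ᵥ q₀) • a jj.1
  have hvv : ∀ jj : Fin f × Fin f, jj.1 ≠ jj.2 → vv jj ≠ 0 := by
    rintro ⟨j, j'⟩ hjj hv0
    simp only at hjj
    have hα : b j - a j ⬝ᵥ q₀ ≠ 0 := sub_ne_zero.mpr (Ne.symm (hq₀H j))
    set μ : ℝ := (b j' - a j' ⬝ᵥ q₀) / (b j - a j ⬝ᵥ q₀) with hμ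
    have haj' : a j' = μ • a j := by
      have h1 : (b j - a j ⬝ᵥ q₀) • a j' = (b j' - a j' ⬝ᵥ q₀) • a j := sub_eq_zero.mp hv0
      rw [hμ, div_eq_mul_inv, mul_comm, mul_smul, ← h1, smul_smul, inv_mul_cancel₀ hα, one_smul]
    have hbj' : b j' = μ * b j := by
      have : a j' ⬝ᵥ q₀ = μ * (a j ⬝ᵥ q₀) := by rw [haj', smul_dotProduct, smul_eq_mul]
      rw [hμ] at this ⊢
      field_simp at this ⊢
      linarith
    rcases lt_or_ge 0 μ with hμ0 | hμ0
    · -- inequality `j'` is a positive multiple of inequality `j`: redundant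
      apply hirr j'
      ext y
      simp only [Set.mem_setOf_eq]
      refine ⟨fun hy i => ?_, fun hy i _ => hy i⟩
      by_cases hij : i = j'
      · subst hij
        rw [haj', hbj', smul_dotProduct, smul_eq_mul]
        exact mul_le_mul_of_nonneg_left (hy j hjj) hμ0.le
      · exact hy i hij
    · -- `μ ≤ 0`: the two inequalities pinch the interior point
      have h1 := hpstrict j
      have h2 := hpstrict j'
      rw [haj', hbj', smul_dotProduct, smul_eq_mul] at h2
      nlinarith
  -- a direction meeting all hyperplanes at distinct parameters
  obtain ⟨e, he⟩ := exists_dotProduct_ne_zero_of_finite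
    (L := Fin f ⊕ {jj : Fin f × Fin f // jj.1 ≠ jj.2}) (Sum.elim a fun jj => vv jj.1) (by
      rintro (j | ⟨jj, hjj⟩)
      · exact ha0 j
      · exact hvv jj hjj)
  have hea : ∀ j, a j ⬝ᵥ e ≠ 0 := fun j => he (Sum.inl j)
  let τ : Fin f → ℝ := fun j => (b j - a j ⬝ᵥ q₀) / (a j ⬝ᵥ e)
  have hτH : ∀ j, a j ⬝ᵥ (q₀ + τ j • e) = b j := fun j => by
    rw [dotProduct_add, dotProduct_smul, smul_eq_mul, div_mul_cancel₀ _ (hea j)]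
    ring
  have hτinj : Function.Injective τ := by
    intro j j' hjj
    by_contra hne
    apply he (Sum.inr ⟨(j, j'), hne⟩)
    simp only [Sum.elim_inr, vv, sub_dotProduct, smul_dotProduct, smul_eq_mul]
    have h := hjj
    simp only [τ] at h
    rw [div_eq_div_iff (hea j) (hea j')] at h
    linarith
  -- root count on the line `q₀ + t e`
  have hcard : f ≤ P.totalDegree := by
    have := card_le_totalDegree_of_eval_line_eq_zero P q₀ e hq₀P (Finset.univ.image τ)
      (fun t ht => by
        obtain ⟨j, -, rfl⟩ := Finset.mem_image.mp ht
        exact hPH j _ (hτH j))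
    rwa [Finset.card_image_of_injective _ hτinj, Finset.card_univ, Fintype.card_fin] at this
  exact hcard

/-- **FGPRT Corollary 5.13 from Proposition 5.12** ("the degree of a polytope is its number of facets",
p16): given Prop. 5.12 (a nonzero polynomial of degree `≤ k^{O(k²n)}` vanishing on `∂C` whenever the
full-dimensional convex `C` has an `S^k_+`-lift), a full-dimensional polytope with an irredundant
description by `f` inequalities whose slack matrix has a psd factorization of size `k` has
`f ≤ k^{O(k²n)}` (same constant): `C` has an `S^k_+`-lift by Theorem 3.3 (`FawziEtAl2015_thm33_holds`);
the polynomial vanishes on a relatively open piece of each facet hyperplane, hence (restricting to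
lines, `Polynomial.eq_zero_of_infinite_isRoot`) on each of the `f` distinct hyperplanes; a generic
line through a point where `P ≠ 0` meets them in `f` distinct parameters, so `f ≤ deg P`.
[cite: FawziEtAl2015, Cor. 5.13 (p16)] -/
theorem FawziEtAl2015_cor513_of_prop512 (h512 : FawziEtAl2015_prop512) : FawziEtAl2015_cor513 := by
  classical
  obtain ⟨c, hc, h512⟩ := h512
  refine ⟨c, hc, fun n v f k x a b hint hVH hirr hpsd => ?_⟩
  obtain ⟨p, hp⟩ := hint
  have hmemQ : ∀ y, y ∈ convexHull ℝ (Set.range x) ↔ ∀ j, a j ⬝ᵥ y ≤ b j := fun y => by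
    rw [hVH]; rfl
  -- the trivial case `f = 0`
  rcases Nat.eq_zero_or_pos f with hf0 | hf
  · subst hf0
    simp only [CharP.cast_eq_zero]
    exact Real.rpow_nonneg (Nat.cast_nonneg k) _
  -- `k ≥ 1`: some vertex is off the facet hyperplane `j₀` (else `C ⊆ H_{j₀}` has empty interior)
  set j₀ : Fin f := ⟨0, hf⟩
  have hpj₀ : a j₀ ⬝ᵥ p < b j₀ := by
    -- as in `card_facets_le_totalDegree_of_eval_frontier_eq_zero`: `a_{j₀} ≠ 0` by irredundancy,
    -- and interior points are strict
    have ha0 : a j₀ ≠ 0 := by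
      intro hj
      apply hirr j₀
      ext y
      simp only [Set.mem_setOf_eq]
      refine ⟨fun hy i => ?_, fun hy i _ => hy i⟩
      by_cases hij : i = j₀
      · subst hij
        have := (hmemQ p).mp (interior_subset hp) j₀
        rw [hj, zero_dotProduct] at this ⊢
        exact this
      · exact hy i hij
    have hcont : Continuous fun t : ℝ => p + t • a j₀ :=
      continuous_const.add (continuous_id.smul continuous_const)
    have hev : ∀ᶠ t in nhds (0 : ℝ), p + t • a j₀ ∈ convexHull ℝ (Set.range x) := by
      have h0 : convexHull ℝ (Set.range x) ∈ nhds (p + (0 : ℝ) • a j₀) := by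
        rw [zero_smul, add_zero]; exact mem_interior_iff_mem_nhds.mp hp
      exact hcont.continuousAt.preimage_mem_nhds h0
    obtain ⟨t, htC, ht⟩ :=
      ((hev.filter_mono nhdsWithin_le_nhds).and (eventually_mem_nhdsWithin (s := Set.Ioi 0))).exists
    have h1 : a j₀ ⬝ᵥ (p + t • a j₀) ≤ b j₀ := (hmemQ _).mp htC j₀
    rw [dotProduct_add, dotProduct_smul, smul_eq_mul] at h1
    have h2 : 0 < a j₀ ⬝ᵥ a j₀ :=
      lt_of_le_of_ne (Finset.sum_nonneg fun i _ => mul_self_nonneg _)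
        (Ne.symm (mt dotProduct_self_eq_zero.mp ha0))
    have ht0 : (0 : ℝ) < t := ht
    nlinarith [mul_pos ht0 h2]
  have hk : 1 ≤ k := by
    by_contra hk0
    have hk0' : k = 0 := by omega
    subst hk0'
    obtain ⟨A, B, -, -, hS⟩ := hpsd
    have hon : ∀ i, a j₀ ⬝ᵥ x i = b j₀ := fun i => by
      have := hS i j₀
      simp only [Matrix.trace, Finset.univ_eq_empty, Finset.sum_empty] at this
      linarith
    have hsub : convexHull ℝ (Set.range x) ⊆ {y | a j₀ ⬝ᵥ y = b j₀} :=
      convexHull_min (Set.range_subset_iff.mpr hon) (convex_setOf_dotProduct_eq _ _)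
    have := hsub (interior_subset hp)
    exact absurd this (ne_of_lt hpj₀)
  -- the polynomial of Proposition 5.12 and the facet count
  have hlift : HasPsdLift (convexHull ℝ (Set.range x)) k :=
    (FawziEtAl2015_thm33_holds n v f k x a b hk hVH).mp hpsd
  obtain ⟨P, hP0, hPfr, hPdeg⟩ := h512 n k _ (convex_convexHull ℝ _) ⟨p, hp⟩ hlift
  have hcard : f ≤ P.totalDegree :=
    card_facets_le_totalDegree_of_eval_frontier_eq_zero x a b ⟨p, hp⟩ hVH hirr hP0 hPfr
  calc (f : ℝ) ≤ (P.totalDegree : ℝ) := by exact_mod_cast hcard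
    _ ≤ (k : ℝ) ^ (c * (k : ℝ) ^ 2 * n) := hPdeg

end Cor513

end Literature.Combinatorics.Optimization
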